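import Summits.ResolutionOfSingularities.ResolutionOfSingularities.Theorems.PinchTowerAlg

/-!
# PinchTower (P2/8) — `τ ≤ 1` as a congruence, the binomial step, THE MIXED EXIT (E12) `k + r = n`

Node «PinchTower» of `decomp-res-lens-2` (g31), see `Theorems/MaxContactCutPinchTower.lean`.

* `exists_sub_mem_pow_succ_of_tau_le_one`: for a minimal basis `x` of `𝔪` with `hironakaTauAt x J n ≤ 1`, every
  `h ∈ J ∩ 𝔪ⁿ` is `≡ c·(Σ aᵢxᵢ)ⁿ (mod 𝔪ⁿ⁺¹)` (from the tree's `hironakaTau_eq_zero_iff` /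
  `exists_forall_eq_C_mul_pow_of_hironakaTau_eq_one` and `eval_mem_mul_span_pow`);
* `add_pow_sub_pow_mem`: `(p + q)ⁿ − pⁿ ∈ Iⁿ⁺¹` for `p ∈ I`, `q ∈ I²`;
* `pinch_two_le_tau` [KERNEL]: THE MIXED EXIT — `h = zⁿ + uʳ λ vᵏ + g ∈ J ⊆ 𝔪ⁿ`, `g ∈ (z) + (u^{r+1})`, `r + k = n`,
  `r, k ≥ 1` ⇒ `τ(J, n) ≥ 2`, by the pinch order bound `pinch_not_mem_pow` (P1).

Sources: [Hironaka1964] Ch. III §3; [CossartJannsenSaito2020] Ch. 2; [CossartPiltant2008] Prop. 4.2.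
-/

open IsLocalRing
open Literature.AlgebraicGeometry.Resolution

namespace Summit.ResolutionOfSingularities.ResolutionOfSingularities.Theorems.PinchTower

/-! ## §T  `τ ≤ 1` as a congruence, the binomial step, THE MIXED EXIT -/

section Tau

open MvPolynomial

variable {A : Type} [CommRing A] [IsLocalRing A]

omit [IsLocalRing A] in
/-- **Binomial step**: `(p + q)ⁿ − pⁿ ∈ Iⁿ⁺¹` for `p ∈ I`, `q ∈ I²`. [folklore] -/
theorem add_pow_sub_pow_mem {I : Ideal A} {p q : A} (hp : p ∈ I) (hq : q ∈ I ^ 2) (n : ℕ) :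
    (p + q) ^ n - p ^ n ∈ I ^ (n + 1) := by
  induction n with
  | zero => simp
  | succ n ih =>
    have heq : (p + q) ^ (n + 1) - p ^ (n + 1) = ((p + q) ^ n - p ^ n) * (p + q) + p ^ n * q := by ring
    rw [heq]
    refine Ideal.add_mem _ ?_ ?_
    · rw [pow_succ]
      exact Ideal.mul_mem_mul ih (I.add_mem hp (Ideal.pow_le_self two_ne_zero hq))
    · rw [show n + 1 + 1 = n + 2 by ring, pow_add]
      exact Ideal.mul_mem_mul (Ideal.pow_mem_pow hp n) hq

/-- Forms with coefficients in `𝔪` are those whose reduction vanishes. [folklore] -/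
theorem map_residue_eq_zero_iff {ι : Type} (F : MvPolynomial ι A) :
    MvPolynomial.map (residue A) F = 0 ↔ F ∈ Ideal.map (C : A →+* MvPolynomial ι A) (maximalIdeal A) := by
  rw [MvPolynomial.mem_map_C_iff, MvPolynomial.ext_iff]
  simp_rw [coeff_map, coeff_zero, IsLocalRing.residue_eq_zero_iff]

/-- **`τ ≤ 1` as a congruence**: for a minimal basis `x` of `𝔪` with `hironakaTauAt x J n ≤ 1` (`n ≥ 1`), every
`h ∈ J ∩ 𝔪ⁿ` satisfies `h ≡ c·(Σ aᵢ xᵢ)ⁿ (mod 𝔪ⁿ⁺¹)` for some `c, aᵢ ∈ A` — `τ = 0`: the initial form of `h` is a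
constant of degree `n ≥ 1`, i.e. `0` (take `c = 0`); `τ = 1`: it is `c̄·ℓ̄ⁿ` with `ℓ̄` spanning the directrix
(`exists_forall_eq_C_mul_pow_of_hironakaTau_eq_one`); lift `c̄, ℓ̄` and note that a form with coefficients in `𝔪`
evaluates into `𝔪ⁿ⁺¹` (`eval_mem_mul_span_pow`). [cite: CossartJannsenSaito2020, Ch. 2] -/
theorem exists_sub_mem_pow_succ_of_tau_le_one {d : ℕ} (x : Fin d → A)
    (hx : Ideal.span (Set.range x) = maximalIdeal A) {J : Ideal A} {n : ℕ} (hn : 1 ≤ n)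
    (hτ : hironakaTauAt x J n ≤ 1) {h : A} (hJ : h ∈ J) (hm : h ∈ maximalIdeal A ^ n) :
    ∃ (c : A) (a : Fin d → A), h - c * (∑ i, a i * x i) ^ n ∈ maximalIdeal A ^ (n + 1) := by
  classical
  obtain ⟨F, hFh, hFe⟩ := exists_isHomogeneous_of_mem_span_pow x n (by rw [hx]; exact hm)
  set G := MvPolynomial.map (residue A) F with hG
  have hGmem : G ∈ initialForms x J n := (mem_initialForms_iff x).mpr ⟨F, hFh, by rw [hFe]; exact hJ, rfl⟩
  have hGh : G.IsHomogeneous n := hFh.map _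
  -- a lift `F₀` of the initial form with `F₀(x)` of the required shape gives the congruence
  have key : ∀ F₀ : MvPolynomial (Fin d) A, F₀.IsHomogeneous n → MvPolynomial.map (residue A) F₀ = G →
      h - MvPolynomial.eval x F₀ ∈ maximalIdeal A ^ (n + 1) := by
    intro F₀ hF₀ hF₀G
    have hdiff : MvPolynomial.map (residue A) (F - F₀) = 0 := by rw [map_sub, ← hG, hF₀G, sub_self]
    have hmem := eval_mem_mul_span_pow x (hFh.sub hF₀) ((map_residue_eq_zero_iff _).mp hdiff)
    rw [map_sub, hFe, hx, ← pow_succ'] at hmem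
    exact hmem
  have hτ' : hironakaTau (ResidueField A) (initialForms x J n : Set (MvPolynomial (Fin d) (ResidueField A))) ≤ 1 :=
    hτ
  rcases Nat.lt_or_ge (hironakaTau (ResidueField A)
    (initialForms x J n : Set (MvPolynomial (Fin d) (ResidueField A)))) 1 with h0 | h1
  · -- `τ = 0`
    have hτ0 : hironakaTau (ResidueField A)
        (initialForms x J n : Set (MvPolynomial (Fin d) (ResidueField A))) = 0 := by omega
    obtain ⟨c, hc⟩ := (hironakaTau_eq_zero_iff (ResidueField A) _).mp hτ0 hGmem
    have hG0 : G = 0 := by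
      by_contra hne
      have hdeg0 : G.IsHomogeneous 0 := by rw [← hc]; exact isHomogeneous_C _ _
      exact absurd (hdeg0.inj_right hGh hne) (by omega)
    refine ⟨0, 0, ?_⟩
    have := key 0 (isHomogeneous_zero _ _ _) (by rw [map_zero, hG0])
    simpa using this
  · -- `τ = 1`
    have hτ1 : hironakaTau (ResidueField A)
        (initialForms x J n : Set (MvPolynomial (Fin d) (ResidueField A))) = 1 := le_antisymm hτ' h1
    obtain ⟨ℓ, -, -, hℓ⟩ := exists_forall_eq_C_mul_pow_of_hironakaTau_eq_one (ResidueField A) hτ1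
    obtain ⟨cbar, hc⟩ := hℓ G hGmem n hGh
    obtain ⟨c, rfl⟩ := IsLocalRing.residue_surjective cbar
    choose a ha using fun i => IsLocalRing.residue_surjective (ℓ (Pi.single i 1))
    refine ⟨c, a, ?_⟩
    set F₀ : MvPolynomial (Fin d) A := C c * (∑ i, C (a i) * X i) ^ n with hF₀
    have hL : (∑ i, C (a i) * X i : MvPolynomial (Fin d) A).IsHomogeneous 1 := by
      refine IsHomogeneous.sum _ _ _ fun i _ => ?_
      have h1 := (isHomogeneous_C (Fin d) (a i)).mul (isHomogeneous_X A i)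
      rwa [zero_add] at h1
    have hF₀h : F₀.IsHomogeneous n := by
      have h1 : F₀.IsHomogeneous (0 + 1 * n) := (isHomogeneous_C (Fin d) c).mul (hL.pow n)
      have e : 0 + 1 * n = n := by omega
      rw [e] at h1
      exact h1
    have hF₀G : MvPolynomial.map (residue A) F₀ = G := by
      rw [hc, hF₀, map_mul, map_C, map_pow, map_sum, linearFormPoly]
      congr 2
      refine Finset.sum_congr rfl fun i _ => ?_
      rw [map_mul, map_C, map_X, ha]
    have hev : MvPolynomial.eval x F₀ = c * (∑ i, a i * x i) ^ n := by
      simp only [hF₀, map_mul, map_pow, map_sum, eval_C, eval_X]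
    have := key F₀ hF₀h hF₀G
    rwa [hev] at this

variable [IsNoetherianRing A]

/-- **THE MIXED EXIT (E12), `k + r = n`** [KERNEL]: `h = zⁿ + uʳ·λvᵏ + g ∈ J` with `g ∈ (z) + (u^{r+1})`,
`1 ≤ r`, `1 ≤ k`, `(z, u)` and `(z, u, v)` r.s.o.p.-parts, `λ` a unit, `J ⊆ 𝔪ⁿ`: then `hironakaTauAt x J n ≥ 2` for every
minimal basis `x` of `𝔪`.  Else `h ≡ c·ℓⁿ (mod 𝔪ⁿ⁺¹)`; if `c ∈ 𝔪` then `h ∈ 𝔪ⁿ⁺¹`; if `c` is a unit then modulo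
`(z, u)` `ℓ̿ⁿ ∈ 𝔪̿ⁿ⁺¹` forces `ℓ ∈ (z, u) + 𝔪²`, `ℓ = z b₀ + u b₁ + μ`, and `c ℓⁿ ≡ c uⁿ b₁ⁿ (mod (z) + 𝔪ⁿ⁺¹)`; either
way `uʳ(λ vᵏ + u·s) + z·b ∈ 𝔪^{r+k+1}` for suitable `s, b`, against the pinch order bound. [cite: Hironaka1964, Ch. III] -/
theorem pinch_two_le_tau {z u v lam g : A} {J : Ideal A} {n r k : ℕ} (hzu : IsRsopPart ![z, u])
    (hzuv : IsRsopPart ![z, u, v]) (hlam : IsUnit lam) (hr : 1 ≤ r) (hk : 1 ≤ k) (hrk : r + k = n)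
    (hmem : z ^ n + u ^ r * (lam * v ^ k) + g ∈ J) (hg : g ∈ Ideal.span {z} ⊔ Ideal.span {u ^ (r + 1)})
    (hJ : J ≤ maximalIdeal A ^ n) {d : ℕ} (x : Fin d → A) (hx : Ideal.span (Set.range x) = maximalIdeal A) :
    2 ≤ hironakaTauAt x J n := by
  classical
  by_contra hlt
  rw [not_le] at hlt
  have hn : 1 ≤ n := by omega
  obtain ⟨c, a, hca⟩ := exists_sub_mem_pow_succ_of_tau_le_one x hx hn (by omega) hmem (hJ hmem)
  set ℓ := ∑ i, a i * x i with hℓ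
  have hℓm : ℓ ∈ maximalIdeal A := by
    refine Ideal.sum_mem _ fun i _ => Ideal.mul_mem_left _ _ ?_
    rw [← hx]; exact Ideal.subset_span ⟨i, rfl⟩
  -- `g = z g₁ + u^{r+1} g₂`
  obtain ⟨g₁', hg₁', g₂', hg₂', hgsum⟩ := Submodule.mem_sup.mp hg
  obtain ⟨g₁, rfl⟩ := Ideal.mem_span_singleton'.mp hg₁'
  obtain ⟨g₂, rfl⟩ := Ideal.mem_span_singleton'.mp hg₂'
  obtain ⟨n', hn'⟩ : ∃ n', n = n' + 1 := ⟨n - 1, by omega⟩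
  obtain ⟨k', hk'⟩ : ∃ k', k = k' + 1 := ⟨k - 1, by omega⟩
  have hzm : z ∈ maximalIdeal A := hzu.mem_maximalIdeal 0
  have hum : u ∈ maximalIdeal A := hzu.mem_maximalIdeal 1
  -- the shape `h − c (u b₁)ⁿ − z q = uʳ(λvᵏ + u s) + z b`
  have shape : ∀ b₁ q : A, z ^ n + u ^ r * (lam * v ^ k) + g - c * (u * b₁) ^ n - z * q =
      u ^ r * (lam * v ^ k + u * (g₂ - c * u ^ k' * b₁ ^ n)) + z * (z ^ n' + g₁ - q) := by
    intro b₁ q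
    rw [← hgsum]
    have e1 : u ^ n = u ^ r * u * u ^ k' := by
      rw [← hrk, hk', pow_add, pow_succ]; ring
    have e2 : z ^ n = z * z ^ n' := by rw [hn', pow_succ']
    rw [mul_pow, e1, e2, pow_succ]
    ring
  by_cases hc : c ∈ maximalIdeal A
  · -- `c ∈ 𝔪`: `h ∈ 𝔪ⁿ⁺¹`
    have hcl : c * ℓ ^ n ∈ maximalIdeal A ^ (n + 1) := by
      rw [pow_succ']; exact Ideal.mul_mem_mul hc (Ideal.pow_mem_pow hℓm n)
    have hh : z ^ n + u ^ r * (lam * v ^ k) + g ∈ maximalIdeal A ^ (n + 1) := by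
      have := Ideal.add_mem _ hca hcl
      rwa [sub_add_cancel] at this
    have := pinch_not_mem_pow (k := k) hzu (Or.inr hzuv) hlam r (g₂ - c * u ^ k' * 0 ^ n) (z ^ n' + g₁ - 0)
    rw [hrk] at this
    apply this
    rw [← shape 0 0, mul_zero, zero_pow (by omega), mul_zero, sub_zero, mul_zero, sub_zero]
    exact hh
  · -- `c` a unit: modulo `(z, u)` the class of `ℓⁿ` lies in `𝔪̿ⁿ⁺¹`, so `ℓ ∈ (z, u) + 𝔪²`
    have hcu : IsUnit c := IsLocalRing.notMem_maximalIdeal.mp hc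
    haveI hreg2 : IsRegularLocalRing (A ⧸ Ideal.span (Set.range ![z, u])) := hzu.isRegularLocalRing_quotient
    set K₂ : Ideal A := Ideal.span (Set.range ![z, u]) with hK₂
    have hzK : z ∈ K₂ := Ideal.subset_span ⟨0, rfl⟩
    have huK : u ∈ K₂ := Ideal.subset_span ⟨1, rfl⟩
    have hhK : z ^ n + u ^ r * (lam * v ^ k) + g ∈ K₂ := by
      rw [← hgsum]
      obtain ⟨r', hr'⟩ : ∃ r', r = r' + 1 := ⟨r - 1, by omega⟩
      refine Ideal.add_mem _ (Ideal.add_mem _ ?_ ?_) (Ideal.add_mem _ ?_ ?_)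
      · rw [hn', pow_succ']; exact Ideal.mul_mem_right _ _ hzK
      · rw [hr', pow_succ']; simp only [mul_assoc]; exact Ideal.mul_mem_right _ _ huK
      · exact Ideal.mul_mem_left _ _ hzK
      · rw [pow_succ']; exact Ideal.mul_mem_left _ _ (Ideal.mul_mem_right _ _ huK)
    have h1 : Ideal.Quotient.mk K₂ (c * ℓ ^ n) ∈ maximalIdeal (A ⧸ K₂) ^ (n + 1) := by
      have h' : c * ℓ ^ n = (z ^ n + u ^ r * (lam * v ^ k) + g) - (z ^ n + u ^ r * (lam * v ^ k) + g - c * ℓ ^ n) := by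
        ring
      rw [h', map_sub, Ideal.Quotient.eq_zero_iff_mem.mpr hhK, zero_sub, neg_mem_iff,
        ← map_mk_maximalIdeal_eq K₂, ← Ideal.map_pow]
      exact Ideal.mem_map_of_mem _ hca
    have h2 : Ideal.Quotient.mk K₂ ℓ ^ n ∈ maximalIdeal (A ⧸ K₂) ^ (n + 1) := by
      rw [map_mul, map_pow] at h1
      obtain ⟨w, hw⟩ := hcu.map (Ideal.Quotient.mk K₂)
      have heq : Ideal.Quotient.mk K₂ ℓ ^ n = ↑w⁻¹ * (Ideal.Quotient.mk K₂ c * Ideal.Quotient.mk K₂ ℓ ^ n) := by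
        rw [← hw, ← mul_assoc, Units.inv_mul, one_mul]
      rw [heq]
      exact Ideal.mul_mem_left _ _ h1
    have h3 : Ideal.Quotient.mk K₂ ℓ ∈ maximalIdeal (A ⧸ K₂) ^ 2 := by
      by_contra hℓ2
      have := pow_not_mem_pow_of_not_mem_pow hℓ2 n
      rw [mul_one] at this
      exact this h2
    have h4 : ℓ ∈ K₂ ⊔ maximalIdeal A ^ 2 := (mk_mem_pow_maximalIdeal_iff K₂ ℓ 2).mp h3
    obtain ⟨p, hp, μ, hμ, hpμ⟩ := Submodule.mem_sup.mp h4
    obtain ⟨b, hb⟩ := Ideal.mem_span_range_iff_exists_fun.mp hp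
    -- `ℓ = z b₀ + u b₁ + μ`
    have hℓeq : ℓ = z * b 0 + (u * b 1 + μ) := by
      rw [← hpμ, ← hb, Fin.sum_univ_two]
      simp only [Matrix.cons_val_zero, Matrix.cons_val_one]
      ring
    -- `ℓⁿ − (u b₁ + μ)ⁿ ∈ (z)` and `(u b₁ + μ)ⁿ − (u b₁)ⁿ ∈ 𝔪ⁿ⁺¹`
    obtain ⟨q, hq⟩ : ∃ q, ℓ ^ n - (u * b 1 + μ) ^ n = z * b 0 * q := by
      have hd := sub_dvd_pow_sub_pow ℓ (u * b 1 + μ) n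
      rw [hℓeq, add_sub_cancel_right] at hd
      rw [hℓeq]
      exact hd
    have hstep : (u * b 1 + μ) ^ n - (u * b 1) ^ n ∈ maximalIdeal A ^ (n + 1) :=
      add_pow_sub_pow_mem (Ideal.mul_mem_right _ _ hum) hμ n
    -- assemble: `uʳ(λvᵏ + u s) + z b ∈ 𝔪ⁿ⁺¹`
    have hfinal : z ^ n + u ^ r * (lam * v ^ k) + g - c * (u * b 1) ^ n - z * (c * (b 0 * q)) ∈
        maximalIdeal A ^ (n + 1) := by
      have heq : z ^ n + u ^ r * (lam * v ^ k) + g - c * (u * b 1) ^ n - z * (c * (b 0 * q)) =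
          (z ^ n + u ^ r * (lam * v ^ k) + g - c * ℓ ^ n) + c * ((u * b 1 + μ) ^ n - (u * b 1) ^ n) +
            c * (ℓ ^ n - (u * b 1 + μ) ^ n) - z * (c * (b 0 * q)) := by ring
      rw [heq, hq, show (z ^ n + u ^ r * (lam * v ^ k) + g - c * ℓ ^ n) + c * ((u * b 1 + μ) ^ n - (u * b 1) ^ n) +
            c * (z * b 0 * q) - z * (c * (b 0 * q)) =
          (z ^ n + u ^ r * (lam * v ^ k) + g - c * ℓ ^ n) + c * ((u * b 1 + μ) ^ n - (u * b 1) ^ n) by ring]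
      exact Ideal.add_mem _ hca (Ideal.mul_mem_left _ _ hstep)
    rw [shape] at hfinal
    have := pinch_not_mem_pow (k := k) hzu (Or.inr hzuv) hlam r (g₂ - c * u ^ k' * b 1 ^ n)
      (z ^ n' + g₁ - c * (b 0 * q))
    rw [hrk] at this
    exact this hfinal

end Tau

end Summit.ResolutionOfSingularities.ResolutionOfSingularities.Theorems.PinchTower
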